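import Literature.NumberTheory.EllipticCurves.Kato2004.LocalIwasawaCohomologyMap
import Literature.NumberTheory.EllipticCurves.KatoFineSelmerDual
import Literature.NumberTheory.EllipticCurves.IwasawaSelmer
import Literature.NumberTheory.EllipticCurves.PAdicBSD
import HarnessLib

/-!
# Kato 2004 (Astérisque 295) Thm 12.4 (2), Thm 12.5 (1)(2), Thm 16.4 / 16.6 (2), Prop 17.11, (14.9.3) and §17.13 (p. 280),
# READ AT `p = 2` on the GENUINE carriers `𝐇¹_Γ(T₂W)` (`IwasawaH1Data`) and `𝐇¹_{loc,Γ}(T₂W|_{Γ_{ℚ₂}})`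
# (`LocalIwasawaH1Data`): per curve, the zeta class, the `F⁻`-Coleman map, the first reciprocity law and the `λ`-index
# identity — ONE existence statement (named fact, READING-grade at `2`), nothing else

Topic `NumberTheory/EllipticCurves/Kato2004` (namespace = path).  Seat `bsd-2adic-conv-1` GEN 28 (cell `pub/bsd-2adic`), item
stmt-BirchSwinnertonDyer-19556 `OrdLambdaHalfAtTwo`, line `kato_determinant_greenberg_two` v4.3: the lead's hand-back «F3-K (Kato per
curve X ∈ {W, A} at 2 … on the GENUINE local carrier `J.H` with `H_f = range(ordinaryInclusion J' J)`)» (HOME INBOX 2026-08-29T00:05Z, pen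
RC-360), in the PER-CURVE form (option (a) of the seat's BRIEF-19556-F3: no transport of the twist's class through `W`'s Coleman map — that
is not a printed shape).  Companion of `Kato2004/DivisibilityInputs.lean` (the same theorems as ONE construction fact for ODD `p` on an
ABSTRACT local quotient `P`) and of `Kato2004/LocalIwasawaCohomologyFiniteness.lean` ((12.2.3) at every `p`, whose READING (β₂)-loc
at `p = 2` this file extends to 16.4/17.11); the Summits-side memo-tier package `SteinbergFibreAtTwo.HasZetaColemanMuInputsAtTwo`
(K4, abstract `P`) reads the same pages for a different consumer.

HONEST FRAMING: ONE named fact (`def … : Prop`, +1 declared debt); every conjunct is a numbered statement of Kato 2004 READ AT `p = 2`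
on the `Δ`-trivial (`Γ`-) towers — a READING, labelled as such conjunct by conjunct below, not a verbatim transcription (Kato prints
12.5 (4) and the `(p)`-primary clause of §17.13 under `p ≠ 2`; NEITHER is used).  Nothing is asserted; no `_holds`; no instance, no
notation; nothing here is specific to any summit; BSD is not proved by any of this.

## The printed statements (K. Kato, Astérisque 295 (2004); store `paper:doi-10-24033-ast-639`, printed page = PDF page + 115).
Verbatim quotes of Thm 12.4, (12.2.1) are in `IwasawaCohomology.lean`; of Thm 12.5 (1)–(4), Thm 12.6, Thm 16.6 (2), Prop 17.11, 17.5
and §17.13 (17.13.1)–(17.13.4) with p. 280 in `DivisibilityInputs.lean` (module docstrings) — not repeated here.  Used: **12.4 (2)**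
"`𝐇¹(T)` is a torsion free `Λ`-module, and `𝐇¹(T) ⊗ ℚ` is a free `Λ ⊗ ℚ`-module of rank `1`"; **12.5 (1)** the `F_λ`-linear
`γ ↦ z_γ^{(p)} ∈ 𝐇¹(V_{F_λ}(f))`; **12.5 (2)** "`𝐇¹(V_{F_λ}(f))/Z(f)` is a torsion `Λ ⊗ ℚ`-module"; **16.4 / 17.11** "the homomorphism
`𝔏_η : 𝐇¹_loc(T(k)) → …` induces an injection `𝐇¹_loc(T(k))/𝐇¹_loc(T'(k)) ↪ Λ`, whose cokernel is a finite group" (good ordinary, `T'`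
the `F⁺`-part); **16.6 (2)** "`L_{p-adic,α,ω,γ}(f) = 𝔏_η(z_γ^{(p)}(f*)(k))`"; **(14.9.3)** (p. 240) the fine (`H¹_f`-strict at `p`) Selmer
group inside the Selmer group with local quotient; **§17.13, p. 280**: "Let `𝔭` be a prime ideal of `Λ` of height one. In the case `𝔭`
contains `p`, we assume `p ≠ 2` and [(12.5.2)]. By (17.13.2)–(17.13.4), we obtain from (17.13.1) an exact sequence
`0 → 𝐇¹(T(k))_𝔭 → 𝐇¹_loc(T(k))_𝔭/𝐇¹_loc(T'(k))_𝔭 → 𝔛(T*(1−k))_𝔭 → 𝐇²(T(k))_𝔭 → 0` … By 17.11 and by 12.5, 16.6, we have an isomorphism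
`𝐇¹_loc(T(k))_𝔭/𝐇¹_loc(T'(k))_𝔭 ≅ Λ_𝔭` which sends the image of `Z(f,T)(k)_𝔭` onto `Λ_𝔭 · L_{p-adic,α,ω,γ}(f)`" — at the primes
`𝔭 ∌ p` this carries NO `p ≠ 2` proviso.

## READING AT `p = 2` (what the `def` says, conjunct by conjunct; `Δ = {1, c}`, `Λ_K = ℤ₂[Δ]⟦X⟧`, `Λ = ℤ₂⟦X⟧`; the global `Γ`-tower
## reading (β₂) of `IwasawaCohomology.lean` and the local one (β₂)-loc of `LocalIwasawaCohomologyFiniteness.lean` are assumed known)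

* (R-z) **the class `z ∈ 𝐇¹_Γ(T₂W)`.**  `Z(f,T) ⊂ 𝐇¹(T) ⊗ ℚ` (12.5 (2)(4): integrality `Z(f,T) ⊂ 𝐇¹(T)` is printed for `p ≠ 2` only), so for
  `γ` good for `T` (17.5: Néron) some `2^m z_γ^{(2)}` lies in `𝐇¹(T)`; its corestriction to the `Γ`-tower (the `Δ`-trivial reading (β₂.3):
  `res ∘ cor = 1 + c`) is the `z` of the fact, possibly after a further `2`-power (absorbed in `n`).
* (R-Col) **`Col⁻ : 𝐇¹_{loc,Γ}(T₂W) ⧸ H_f → Λ` with `2`-power-torsion kernel and finite cokernel.**  `H_f := range(ordinaryInclusion)`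
  (`𝐇¹_{loc,Γ}(F⁺T₂W) → 𝐇¹_{loc,Γ}(T₂W)`, tree `LocalIwasawaCohomologyMap.lean`).  Restriction to Kato's tower is injective ((β₂)-loc) and
  lands in the `Δ`-invariants; `𝔏_η` (16.4) is injective on `𝐇¹_loc(T)/𝐇¹_loc(T')` with finite cokernel in `Λ_K` (17.11, no parity
  proviso); the `Δ`-invariants of `Λ_K` are `(1+c)Λ`, and `c ↦ 1` maps them onto `2Λ`; so `Col⁻ := ½·(c ↦ 1) ∘ 𝔏_η ∘ res` is `Λ`-linear
  into `Λ` with finite cokernel; its kernel is `res⁻¹(𝐇¹_loc(T')) ⧸ H_f`, killed by the (finite, `2`-power) index of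
  `res 𝐇¹_{loc,Γ}(F⁺T₂W)` in `𝐇¹_loc(T')^Δ` (inflation–restriction with the finite coefficients `E(ℚ_{n,2}(i))[2^∞]`).  Hence
  «kernel killed by `2^k`, cokernel finite» — the shape of the consumer's `PinnedKatoCore.colMinus_ker/_coker`.
* (R-rec) **first reciprocity law `Col⁻(loc₂ z) = u·2ⁿ·L₀`.**  16.6 (2) in `Λ_K ⊗ ℚ`; `(c ↦ 1)` of `L_{2-adic,α,ω,γ}(f)` is its
  `Δ`-trivial branch, the Mazur–Swinnerton-Dyer function of `E` for the trivial tame character, i.e. `ϖ·padicLFunction f α` with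
  `ϖ·Ω_E = Ω⁺_f` (tree table `PAdicBSD.lean`; on the consumer's habitat `E[2]` is reducible, so `ϖ` need not be a `2`-adic unit — its
  `2`-power is absorbed in `n` by raising the multiple of `z`, its unit part in `u`); orientation `γ ↔ γ⁻¹` costs a unit (MTT §I.17).
* (R-tors) **`𝐇¹_Γ ⧸ Λz` is `Λ`-torsion**: 12.4 (2) read (β₂.3) (`𝐇¹_Γ ⊗ ℚ` free of rank `1`) and `z ≠ 0` (by (R-rec), `L₀ ≠ 0` — Rohrlich,
  tree `padicLFunction_unitRoot_ne_zero`); = 12.5 (2) on the `Δ`-trivial component.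
* (R-index) **`λ(𝐇¹_Γ⧸Λz) + λ(X) = λ(X₀) + λ(Λ⧸(L₀))`** for `X = X(E/ℚ_∞)` finitely generated torsion (`SelmerDualData`) and `X₀ = X₀(E/ℚ_∞)`
  (`FineSelmerDualData`): p. 280's exact sequence and isomorphism at EVERY height-one `𝔭 ∌ 2` (no proviso there), with (14.9.3)
  (`X ↠ X₀` with kernel the image of `𝐇¹_loc⧸H_f`) and (17.13.4) (`𝐇²_loc` finite), summed over `𝔭 ≠ (2)` with multiplicities
  (`λ(M) = Σ_{𝔭 ≠ (p)} length(M_𝔭)·deg 𝔭`): `λ(𝐇¹_loc⧸H_f ⧸ loc Λz) = λ(Λ⧸(L₀))`, `λ(𝐇¹_loc⧸H_f ⧸ loc 𝐇¹) = λ(X) − λ(X₀)`, loc injective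
  ((17.13.2)).  The `Γ`-tower modules differ from Kato's `Δ`-components by kernels/cokernels killed by `2` ((β₂)), invisible at `𝔭 ∌ 2`.
-- TODO(general form): Kato's statements for arbitrary newforms `f` of weight `k ≥ 2`, all `Δ`-components and twists `(r)`, the
-- primes `𝔭 ∋ p` under `p ≠ 2` ∧ (12.5.2) (12.5 (4), 17.4 (3)), and `𝐇²`, `𝐇²_loc` as objects.

## Why it might be wrong (for the auditor): only through a mis-booked `p = 2` defect that is NOT `2`-primary-and-bounded — every defect
named above is a kernel/cokernel killed by `2` (hence `λ`-invisible and absorbed by «`2`-power kernel» / the exponent `n`), except the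
finite cokernel of 17.11, printed without parity proviso.  Consumer: the fields `colMinus`, `colMinus_ker`, `colMinus_coker`, `zW`, `nW`,
`unitW`, `recW` (per curve) and the per-curve half of `katoIndex` of `TwoAdicKatoDeterminant.PinnedKatoCore` / `ShapiroKatoGreenbergDatum`
(p679221); `localOrdinaryPart J' J` there is `LinearMap.range (J'.ordinaryInclusion J)` by `rfl`.

## References
* [Kato2004Asterisque] K. Kato, Astérisque 295 (2004): Thm 12.4 (p. 221), Thm 12.5 (pp. 221–222), (14.9.3) (p. 240), Thm 16.4 / 16.6 (p. 271),
  17.5 (p. 274), Prop 17.11 (p. 277), §17.13 (17.13.1)–(17.13.4) and p. 280.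
* [PerrinRiou1994Invent] B. Perrin-Riou, Invent. Math. 115 (1994) (the map `𝔏_η`, Kato's [Pe2]).
* [MazurTateTeitelbaum1986Invent] §I.17 (functional equation; orientation of `Λ`).  Tree: `IwasawaCohomology.lean` (β₂),
  `LocalIwasawaCohomologyFiniteness.lean` (β₂)-loc, `DivisibilityInputs.lean` (odd `p`), `PAdicBSD.lean` (`ϖ`).
-/

open scoped NumberField MatrixGroups ModularForm
open Field IsDedekindDomain CongruenceSubgroup WeierstrassCurve
open Literature.NumberTheory.GaloisRepresentations
open Literature.NumberTheory.EllipticCurves Literature.NumberTheory.EllipticCurves.Kato2004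
open Literature.NumberTheory.EllipticCurves.Kato2004.EulerSystemValues
open Literature.NumberTheory.EllipticCurves.ModularForms

namespace Literature.NumberTheory.EllipticCurves.Kato2004

/-- **Kato 2004 at `p = 2`, per curve, on the genuine carriers: zeta class, `F⁻`-Coleman map, first reciprocity law, torsion
and `λ`-index identity** (Thm 12.4 (2), 12.5 (1)(2), 16.4/16.6 (2), Prop 17.11, (14.9.3), §17.13 p. 280 — READ AT `2` as in the module
docstring (R-z)/(R-Col)/(R-rec)/(R-tors)/(R-index)).  For `W/ℚ` globally minimal with good ORDINARY reduction at `2`, its newform `f`,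
the cyclotomic `ℤ₂`-extension `κ` with a topological generator `γ` matching the cyclotomic variable, an integral lift `L₀` of `L₂(f, α)`
(`α = unitRoot W 2`), the place `v = (2)`, a local lift `γᵥ` of the generator, and the pinned carriers `I = 𝐇¹_Γ(T₂W)`,
`J = 𝐇¹_{loc,Γ}(T₂W|_{Γ_{ℚ₂}})`, `J' = 𝐇¹_{loc,Γ}(F⁺T₂W)`: there exist `z ∈ I.H`, a `Λ`-linear
`Col⁻ : J.H ⧸ range(ordinaryInclusion) → Λ` whose kernel is killed by a power of `2` and whose cokernel is finite, a unit `u` and `n : ℕ`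
with `Col⁻(loc₂ z) = u·2ⁿ·L₀`, such that `I.H ⧸ Λz` is `Λ`-torsion and, for every Selmer dual datum `D` (`X(E/ℚ_∞)`, finitely generated
torsion) and every fine Selmer dual datum `Y` (`X₀(E/ℚ_∞)`), `λ(I.H⧸Λz) + λ(D.X) = λ(Y.X) + λ(Λ⧸(L₀))`.  READING-grade at `p = 2`
(see «Why it might be wrong»); nothing asserted.
-- TODO(general form): all newforms/weights/components; the `(p)`-primary clauses under `p ≠ 2` ∧ (12.5.2); `𝐇²`, `𝐇²_loc` as objects.
[cite: Kato2004Asterisque, Thm 12.4 (2) (p. 221), Thm 12.5 (1)(2) (pp. 221–222), (14.9.3) (p. 240), Thm 16.6 (2) (p. 271), Prop 17.11 (p. 277), §17.13 p. 280]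
[cite: PerrinRiou1994Invent, §3 (the map 𝔏_η)] -/
def exists_zetaClass_colemanMinus_recLaw_index_two : Prop :=
  ∀ (W : WeierstrassCurve ℚ) [W.IsElliptic] [W.IsGloballyMinimal] [ContinuousSMul ℤ_[2] (W.tateModule 2)]
    {N : ℕ} [NeZero N] (f : CuspForm (Gamma0 N) 2), IsNewformOf W f → IsOrdinaryAt W 2 →
    W.HasGoodReductionAtPrime 2 →
    ∀ (κ : ZpExtension ℚ 2) (γ : absoluteGaloisGroup ℚ), κ.IsCyclotomic →
    ∀ (hγ : κ.IsTopGenerator γ), IsCyclotomicVariable 2 γ →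
    ∀ (L₀ : IwasawaAlgebra 2), iwasawaToPowerSeries 2 L₀ = padicLFunction f (unitRoot W 2 : ℚ_[2]) →
    ∀ (v : HeightOneSpectrum (𝓞 ℚ)), ((2 : ℕ) : 𝓞 ℚ) ∈ v.asIdeal →
    ∀ (γᵥ : absoluteGaloisGroup (v.adicCompletion ℚ))
      (hsurj : Function.Surjective
        (κ.toContinuousMonoidHom.comp (resGalOfEmb (closureEmb (K := ℚ) (v.adicCompletion ℚ)))))
      (hγᵥ : κ.IsTopGenerator (resGalOfEmb (closureEmb (K := ℚ) (v.adicCompletion ℚ)) γᵥ))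
      (I : IwasawaH1Data W 2 κ γ) (J : LocalIwasawaH1Data κ v ((tateRep W 2).toLocal v) γᵥ)
      (J' : LocalIwasawaH1Data κ v (tateLocalOrdinaryRep W 2 v) γᵥ),
    ∃ (z : I.H)
      (col : (J.H ⧸ LinearMap.range (J'.ordinaryInclusion J)) →ₗ[IwasawaAlgebra 2] IwasawaAlgebra 2)
      (u : (IwasawaAlgebra 2)ˣ) (n : ℕ),
      (∀ q, col q = 0 → ∃ k : ℕ, (PowerSeries.C ((2 : ℤ_[2]) ^ k) : IwasawaAlgebra 2) • q = 0) ∧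
      Finite (IwasawaAlgebra 2 ⧸ LinearMap.range col) ∧
      col ((LinearMap.range (J'.ordinaryInclusion J)).mkQ (I.loc J hsurj hγ hγᵥ z)) =
        (u : IwasawaAlgebra 2) * PowerSeries.C ((2 : ℤ_[2]) ^ n) * L₀ ∧
      Module.IsTorsion (IwasawaAlgebra 2) (I.H ⧸ Submodule.span (IwasawaAlgebra 2) {z}) ∧
      ∀ (D : W.SelmerDualData κ γ) (Y : W.FineSelmerDualData κ γ),
        Module.Finite (IwasawaAlgebra 2) D.X → Module.IsTorsion (IwasawaAlgebra 2) D.X →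
        lambdaInvariant 2 (I.H ⧸ Submodule.span (IwasawaAlgebra 2) {z}) + lambdaInvariant 2 D.X =
          lambdaInvariant 2 Y.X +
            lambdaInvariant 2 (IwasawaAlgebra 2 ⧸ Ideal.span ({L₀} : Set (IwasawaAlgebra 2)))

end Literature.NumberTheory.EllipticCurves.Kato2004
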